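import Summits.ValiantsHypothesis.ValiantsHypothesis.Theses.FeketeSOS

/-!
# `FeketeSOS.SOSMagnification` (stmt-ValiantsHypothesis-3995) — negative side: the cyclic form of X dies at
# every squarefree composite conductor (CRT)

Standing disprover of the magnification crux (cdisprove gen 4 / cycle 4), from
`Cruxes/SOSMagnification/Disproof.lean` finding 22.  Cycle 3 (`FeketePrimePowerModuli`,
`FeketeImprimitiveModuli`) showed that the EXACT δ-slice of X = `FeketeSOSHard` fails for IMPRIMITIVE quadratic
characters (odd prime-power moduli).  Here: the CYCLIC δ-slice (representations modulo `X^n − 1`, the planner's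
"cleaner cyclic form `Σ cᵢ ĝᵢ² = G·χ` on `ℤ/n`" of item 3996) fails for every `δ > 0` on squarefree composite
moduli `n = q·r`, whose Jacobi character is PRIMITIVE of conductor `n`:

* `crtA_mul_crtB` — for coprime `q, r ≥ 1`, with `A = ∑_{k<q} (rk|q) X^{rk}` and `B = ∑_{l<r} (ql|r) X^{ql}`:
  `A·B = F_{qr} + (X^{qr} − 1)·W` (`W` the explicit wrap-around correction) — by the Chinese remainder theorem
  `(k,l) ↦ rk + ql (mod qr)` is a bijection with `(m|qr) = (rk|q)(ql|r)`;
* `feketeCyclicSlice_false_squarefree` — hence for every `δ > 0` there are arbitrarily large odd squarefree `n`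
  (namely `n = q·r`, `r` the Bertrand prime of a large prime `q`) with a two-square cyclic representation
  `¼(A+B)² − ¼(A−B)² ≡ F_n (mod X^n − 1)` of degree `< n` and support-sum `≤ 2(q+r) < 6√n ≤ n^{1/2+δ}`.

So the cyclic form is STRICTLY stronger than X and owes its life at primes to `ℤ/p` having no proper subgroups,
not to primitivity of `χ`; and cyclic / char-`p` lemmas aimed at X must visibly fail at `n = qr`.  (As exact
polynomials nothing cheap follows: `W` carries about half of the `(q−1)(r−1)` pairs, and no residue systems tile
`[0, qr)` as `rK ⊕ qL`.) [folklore]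
-/

namespace Summit.ValiantsHypothesis.ValiantsHypothesis.Theorems.SOSMagnification.Negative

set_option linter.dupNamespace false

open Polynomial Finset

noncomputable section

/-- CRT factor living on the subgroup `rℤ/qr`: `A = ∑_{k<q} (rk | q) X^{rk}`. -/
def crtA (q r : ℕ) : Polynomial ℂ := ∑ k ∈ range q, C ((jacobiSym (r * k : ℕ) q : ℤ) : ℂ) * X ^ (r * k)

/-- CRT factor living on the subgroup `qℤ/qr`: `B = ∑_{l<r} (ql | r) X^{ql}`. -/
def crtB (q r : ℕ) : Polynomial ℂ := ∑ l ∈ range r, C ((jacobiSym (q * l : ℕ) r : ℤ) : ℂ) * X ^ (q * l)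

/-- The CRT exponent map `(k, l) ↦ (rk + ql) mod qr`. -/
def crtρ (q r : ℕ) (x : ℕ × ℕ) : ℕ := (r * x.1 + q * x.2) % (q * r)

/-- coefficient attached to the pair `(k, l)` -/
def crtCoef (q r : ℕ) (x : ℕ × ℕ) : ℂ :=
  ((jacobiSym (r * x.1 : ℕ) q : ℤ) : ℂ) * ((jacobiSym (q * x.2 : ℕ) r : ℤ) : ℂ)

/-- The wrap-around correction `W = ∑_{rk+ql ≥ qr} (rk|q)(ql|r) X^{rk+ql−qr}`. -/
def crtW (q r : ℕ) : Polynomial ℂ :=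
  ∑ x ∈ range q ×ˢ range r, if q * r ≤ r * x.1 + q * x.2 then C (crtCoef q r x) * X ^ crtρ q r x else 0

/-- one monomial: `X^{rk+ql} = X^{ρ} + (X^{qr} − 1)·[wrap]·X^{ρ}` (the exponent wraps at most once). -/
theorem crt_monomial {q r : ℕ} (hq : 0 < q) (hr : 0 < r) (x : ℕ × ℕ) (hx : x ∈ range q ×ˢ range r) :
    (X : Polynomial ℂ) ^ (r * x.1 + q * x.2) =
      X ^ crtρ q r x + (X ^ (q * r) - 1) * (if q * r ≤ r * x.1 + q * x.2 then X ^ crtρ q r x else 0) := by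
  rw [mem_product, mem_range, mem_range] at hx
  have h1 : r * x.1 ≤ r * (q - 1) := Nat.mul_le_mul_left r (by omega)
  have h2 : q * x.2 ≤ q * (r - 1) := Nat.mul_le_mul_left q (by omega)
  have hlt : r * x.1 + q * x.2 < 2 * (q * r) := by
    have e1 : r * (q - 1) + r = r * q := by
      rw [← Nat.mul_succ, Nat.succ_eq_add_one, Nat.sub_add_cancel hq]
    have e2 : q * (r - 1) + q = q * r := by
      rw [← Nat.mul_succ, Nat.succ_eq_add_one, Nat.sub_add_cancel hr]
    nlinarith
  unfold crtρ
  by_cases hw : q * r ≤ r * x.1 + q * x.2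
  · rw [if_pos hw]
    have hmod : (r * x.1 + q * x.2) % (q * r) = r * x.1 + q * x.2 - q * r := by
      rw [Nat.mod_eq_sub_mod hw, Nat.mod_eq_of_lt (by omega)]
    rw [hmod]
    have : r * x.1 + q * x.2 = (r * x.1 + q * x.2 - q * r) + q * r := by omega
    conv_lhs => rw [this, pow_add]
    ring
  · rw [if_neg hw, Nat.mod_eq_of_lt (by omega)]
    ring

/-- `A·B = ∑_{(k,l)} coef · X^{rk+ql}` -/
theorem crtA_mul_crtB_expand (q r : ℕ) :
    crtA q r * crtB q r = ∑ x ∈ range q ×ˢ range r, C (crtCoef q r x) * X ^ (r * x.1 + q * x.2) := by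
  unfold crtA crtB crtCoef
  rw [sum_mul_sum, sum_product]
  refine sum_congr rfl fun k _ => sum_congr rfl fun l _ => ?_
  rw [C_mul, pow_add]; ring

/-- The CRT map is injective on `[0,q) × [0,r)` for coprime `q, r`. -/
theorem crtρ_injOn {q r : ℕ} (hcop : Nat.Coprime q r) :
    Set.InjOn (crtρ q r) (range q ×ˢ range r : Finset (ℕ × ℕ)) := by
  intro x hx y hy hxy
  simp only [coe_product, coe_range, Set.mem_prod, Set.mem_Iio] at hx hy
  unfold crtρ at hxy
  have hmod : r * x.1 + q * x.2 ≡ r * y.1 + q * y.2 [MOD q * r] := hxy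
  -- reduce mod q : r x.1 ≡ r y.1
  have hq' : r * x.1 ≡ r * y.1 [MOD q] := by
    have h := (Nat.ModEq.of_mul_right r hmod)
    -- h : r*x.1 + q*x.2 ≡ r*y.1 + q*y.2 [MOD q]
    have e1 : r * x.1 + q * x.2 ≡ r * x.1 [MOD q] := Nat.add_mul_mod_self_left _ _ _
    have e2 : r * y.1 + q * y.2 ≡ r * y.1 [MOD q] := Nat.add_mul_mod_self_left _ _ _
    exact (e1.symm.trans h).trans e2
  have hk : x.1 ≡ y.1 [MOD q] := Nat.ModEq.cancel_left_of_coprime (by simpa [Nat.coprime_comm] using hcop) hq'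
  have hk' : x.1 = y.1 := Nat.ModEq.eq_of_lt_of_lt hk hx.1 hy.1
  -- reduce mod r : q x.2 ≡ q y.2
  have hr' : q * x.2 ≡ q * y.2 [MOD r] := by
    have h := (Nat.ModEq.of_mul_left q hmod)
    have e1 : r * x.1 + q * x.2 ≡ q * x.2 [MOD r] := by
      show (r * x.1 + q * x.2) % r = (q * x.2) % r
      rw [add_comm]; exact Nat.add_mul_mod_self_left _ _ _
    have e2 : r * y.1 + q * y.2 ≡ q * y.2 [MOD r] := by
      show (r * y.1 + q * y.2) % r = (q * y.2) % r
      rw [add_comm]; exact Nat.add_mul_mod_self_left _ _ _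
    exact (e1.symm.trans h).trans e2
  have hl : x.2 ≡ y.2 [MOD r] := Nat.ModEq.cancel_left_of_coprime (by simpa using hcop.symm) hr'
  have hl' : x.2 = y.2 := Nat.ModEq.eq_of_lt_of_lt hl hx.2 hy.2
  exact Prod.ext hk' hl'

/-- The coefficient at `(k,l)` is the Jacobi symbol of the CRT image: `(rk|q)(ql|r) = (ρ(k,l) | qr)`. -/
theorem crtCoef_eq {q r : ℕ} [NeZero q] [NeZero r] (x : ℕ × ℕ) :
    crtCoef q r x = ((jacobiSym (crtρ q r x : ℕ) (q * r) : ℤ) : ℂ) := by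
  unfold crtCoef crtρ
  rw [← Int.cast_mul]
  congr 1
  rw [jacobiSym.mul_right]
  congr 1
  · rw [jacobiSym.mod_left ((((r * x.1 + q * x.2) % (q * r) : ℕ) : ℤ)) q,
      jacobiSym.mod_left (((r * x.1 : ℕ)) : ℤ) q]
    congr 1
    push_cast
    rw [Int.emod_emod_of_dvd _ (dvd_mul_right (q : ℤ) r), Int.add_mul_emod_self_left]
  · rw [jacobiSym.mod_left ((((r * x.1 + q * x.2) % (q * r) : ℕ) : ℤ)) r,
      jacobiSym.mod_left (((q * x.2 : ℕ)) : ℤ) r]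
    congr 1
    push_cast
    rw [Int.emod_emod_of_dvd _ (dvd_mul_left (r : ℤ) q), add_comm, Int.add_mul_emod_self_left]

/-- **CRT identity.**  For coprime `q, r ≥ 1`:  `A·B = F_{qr} + (X^{qr} − 1)·W` — cyclically, the Jacobi–Fekete
polynomial of a squarefree composite modulus SPLITS into two polynomials with `≤ q` and `≤ r` terms. -/
theorem crtA_mul_crtB {q r : ℕ} (hq : 0 < q) (hr : 0 < r) (hcop : Nat.Coprime q r) :
    crtA q r * crtB q r =
      (∑ m ∈ range (q * r), C ((jacobiSym m (q * r) : ℤ) : ℂ) * X ^ m) + (X ^ (q * r) - 1) * crtW q r := by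
  haveI : NeZero q := ⟨hq.ne'⟩
  haveI : NeZero r := ⟨hr.ne'⟩
  rw [crtA_mul_crtB_expand]
  have step1 : (∑ x ∈ range q ×ˢ range r, C (crtCoef q r x) * (X : Polynomial ℂ) ^ (r * x.1 + q * x.2)) =
      (∑ x ∈ range q ×ˢ range r, C (crtCoef q r x) * X ^ crtρ q r x) + (X ^ (q * r) - 1) * crtW q r := by
    unfold crtW
    rw [mul_sum, ← sum_add_distrib]
    refine sum_congr rfl fun x hx => ?_
    rw [crt_monomial hq hr x hx]
    split_ifs <;> ring
  rw [step1]
  congr 1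
  -- reindex along the CRT bijection
  have hsurj : Set.SurjOn (crtρ q r) (range q ×ˢ range r : Finset (ℕ × ℕ)) (range (q * r) : Finset ℕ) := by
    have hmem : ∀ a ∈ range q ×ˢ range r, crtρ q r a ∈ range (q * r) := fun a _ =>
      mem_range.mpr (Nat.mod_lt _ (Nat.mul_pos hq hr))
    intro m hm
    have := surj_on_of_inj_on_of_card_le (s := range q ×ˢ range r) (t := range (q * r))
      (fun a _ => crtρ q r a) hmem
      (fun a₁ a₂ h₁ h₂ h => crtρ_injOn hcop (mem_coe.mpr h₁) (mem_coe.mpr h₂) h)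
      (by rw [card_product, card_range, card_range, card_range]) m hm
    obtain ⟨a, ha, rfl⟩ := this
    exact ⟨a, ha, rfl⟩
  refine sum_nbij (crtρ q r) (fun a _ => mem_range.mpr (Nat.mod_lt _ (Nat.mul_pos hq hr)))
    (crtρ_injOn hcop) hsurj fun x _ => ?_
  rw [crtCoef_eq]

/-- a sum of `|s|` weighted monomials has at most `|s|` terms -/
theorem crt_card_support_sum_le {ι : Type*} (s : Finset ι) (a : ι → ℂ) (e : ι → ℕ) :
    (∑ i ∈ s, C (a i) * X ^ (e i)).support.card ≤ s.card := by
  classical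
  induction s using Finset.induction_on with
  | empty => simp
  | @insert i s hi ih =>
    rw [sum_insert hi, card_insert_of_notMem hi]
    have h1 := card_le_card (support_add (p := C (a i) * X ^ e i) (q := ∑ j ∈ s, C (a j) * X ^ e j))
    have h2 := card_union_le (C (a i) * X ^ e i).support (∑ j ∈ s, C (a j) * X ^ e j).support
    have h3 : (C (a i) * X ^ e i).support.card ≤ 1 := card_support_C_mul_X_pow_le_one
    omega

/-- `A` has at most `q` terms. -/
theorem card_support_crtA_le (q r : ℕ) : (crtA q r).support.card ≤ q := by
  have h := crt_card_support_sum_le (range q) (fun k => ((jacobiSym (r * k : ℕ) q : ℤ) : ℂ))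
    (fun k => r * k)
  rw [card_range] at h
  exact h

/-- `B` has at most `r` terms. -/
theorem card_support_crtB_le (q r : ℕ) : (crtB q r).support.card ≤ r := by
  have h := crt_card_support_sum_le (range r) (fun l => ((jacobiSym (q * l : ℕ) r : ℤ) : ℂ))
    (fun l => q * l)
  rw [card_range] at h
  exact h

/-- `deg A < qr`. -/
theorem natDegree_crtA_lt {q r : ℕ} (hq : 0 < q) (hr : 0 < r) : (crtA q r).natDegree < q * r := by
  unfold crtA
  refine lt_of_le_of_lt (natDegree_sum_le_of_forall_le _ _ (n := r * (q - 1)) fun k hk => ?_) ?_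
  · exact (natDegree_C_mul_X_pow_le _ _).trans (Nat.mul_le_mul_left r (by have := mem_range.mp hk; omega))
  · have : r * (q - 1) + r = q * r := by
      rw [← Nat.mul_succ, Nat.succ_eq_add_one, Nat.sub_add_cancel hq, mul_comm]
    omega

/-- `deg B < qr`. -/
theorem natDegree_crtB_lt {q r : ℕ} (hq : 0 < q) (hr : 0 < r) : (crtB q r).natDegree < q * r := by
  unfold crtB
  refine lt_of_le_of_lt (natDegree_sum_le_of_forall_le _ _ (n := q * (r - 1)) fun l hl => ?_) ?_
  · exact (natDegree_C_mul_X_pow_le _ _).trans (Nat.mul_le_mul_left q (by have := mem_range.mp hl; omega))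
  · have : q * (r - 1) + q = q * r := by
      rw [← Nat.mul_succ, Nat.succ_eq_add_one, Nat.sub_add_cancel hr]
    omega

/-- support of a sum / difference -/
theorem crt_card_support_add_le (P Q : Polynomial ℂ) :
    (P + Q).support.card ≤ P.support.card + Q.support.card :=
  (card_le_card support_add).trans (card_union_le _ _)

/-- support of a difference -/
theorem crt_card_support_sub_le (P Q : Polynomial ℂ) :
    (P - Q).support.card ≤ P.support.card + Q.support.card := by
  rw [sub_eq_add_neg, ← support_neg (p := Q)]; exact crt_card_support_add_le P (-Q)

/-- **The cyclic form of X fails at every scale on squarefree composite (primitive!) conductors.**  The refuted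
statement is the CYCLIC δ-slice of X over odd squarefree moduli (Jacobi symbol; representations modulo `X^n − 1`
with squares of degree `< n`) — at primes the planner's "cleaner cyclic form" of item 3996.
Witness: `n = q·r` with `q` a large prime and `r` its Bertrand prime (`q < r < 2q`): by `crtA_mul_crtB`,
`¼(A+B)² − ¼(A−B)² = A·B ≡ F_n (mod X^n − 1)` with support-sum `≤ 2(q + r) < 6q ≤ 6√n ≤ n^{1/2+δ}`. -/
theorem feketeCyclicSlice_false_squarefree {δ : ℝ} (hδ : 0 < δ) :
    ¬ (∃ n₀ : ℕ, ∀ n : ℕ, n₀ ≤ n → Odd n → Squarefree n →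
        ∀ (s : ℕ) (c : Fin s → ℂ) (g : Fin s → Polynomial ℂ) (R : Polynomial ℂ), (s : ℝ) ≤ (n : ℝ) ^ δ →
          (∀ i, (g i).natDegree < n) →
          (∑ i, C (c i) * g i ^ 2) = (∑ m ∈ range n, C ((jacobiSym m n : ℤ) : ℂ) * X ^ m) + (X ^ n - 1) * R →
          (n : ℝ) ^ (1 / 2 + δ) ≤ ∑ i, ((g i).support.card : ℝ)) := by
  rintro ⟨n₀, H⟩
  obtain ⟨q, hq_ge, hqprime⟩ := Nat.exists_infinite_primes (max (max n₀ 3) (⌈(6 : ℝ) ^ (1 / δ)⌉₊ + 1))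
  obtain ⟨r, hrprime, hqr, hr2q⟩ := Nat.exists_prime_lt_and_le_two_mul q hqprime.ne_zero
  have hq3 : 3 ≤ q := le_trans (le_max_right _ _) (le_trans (le_max_left _ _) hq_ge)
  have hq0 : 0 < q := by omega
  have hr0 : 0 < r := by omega
  have hqodd : Odd q := hqprime.odd_of_ne_two (by omega)
  have hrodd : Odd r := hrprime.odd_of_ne_two (by omega)
  have hrlt : r < 2 * q := by
    rcases Nat.lt_or_ge r (2 * q) with h | h
    · exact h
    · exfalso
      have : r = 2 * q := le_antisymm hr2q h
      exact (Nat.not_even_iff_odd.mpr hrodd) ⟨q, by omega⟩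
  have hcop : Nat.Coprime q r := (Nat.coprime_primes hqprime hrprime).mpr (by omega)
  set n := q * r with hn
  have hn0 : 0 < n := Nat.mul_pos hq0 hr0
  have hnodd : Odd n := Nat.odd_mul.mpr ⟨hqodd, hrodd⟩
  have hnsq : Squarefree n :=
    (Nat.squarefree_mul hcop).mpr ⟨hqprime.prime.squarefree, hrprime.prime.squarefree⟩
  have hn₀ : n₀ ≤ n := by
    have : n₀ ≤ q := le_trans (le_max_left _ _) (le_trans (le_max_left _ _) hq_ge)
    exact this.trans (Nat.le_mul_of_pos_right q hr0)
  -- the two squares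
  set A := crtA q r with hA
  set B := crtB q r with hB
  have h4 : (C (4 : ℂ)⁻¹ : Polynomial ℂ) * 4 = 1 := by
    rw [← map_ofNat C 4, ← C_mul, inv_mul_cancel₀ (by norm_num), C_1]
  have hrep : (∑ i, C ((![(4 : ℂ)⁻¹, -(4 : ℂ)⁻¹]) i) * (![A + B, A - B]) i ^ 2) =
      (∑ m ∈ range n, C ((jacobiSym m n : ℤ) : ℂ) * X ^ m) + (X ^ n - 1) * crtW q r := by
    simp only [Fin.sum_univ_two, Matrix.cons_val_zero, Matrix.cons_val_one]
    rw [hn, ← crtA_mul_crtB hq0 hr0 hcop, ← hA, ← hB, map_neg]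
    linear_combination (A * B) * h4
  have hdegA : A.natDegree < n := natDegree_crtA_lt hq0 hr0
  have hdegB : B.natDegree < n := natDegree_crtB_lt hq0 hr0
  have hdeg : ∀ i, ((![A + B, A - B]) i).natDegree < n := by
    intro i
    fin_cases i
    · exact lt_of_le_of_lt (natDegree_add_le _ _) (max_lt hdegA hdegB)
    · exact lt_of_le_of_lt (natDegree_sub_le _ _) (max_lt hdegA hdegB)
  -- reals
  have hq1 : (1 : ℝ) ≤ (q : ℝ) := by exact_mod_cast hq0
  have hn1 : (1 : ℝ) ≤ (n : ℝ) := by exact_mod_cast hn0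
  have hnpos : (0 : ℝ) < (n : ℝ) := by linarith
  have hceil : (6 : ℝ) ^ (1 / δ) ≤ (q : ℝ) := by
    have h1 : (⌈(6 : ℝ) ^ (1 / δ)⌉₊ : ℝ) ≤ (q : ℝ) := by
      have : ⌈(6 : ℝ) ^ (1 / δ)⌉₊ ≤ q := le_trans (by omega) (le_trans (le_max_right _ _) hq_ge)
      exact_mod_cast this
    exact le_trans (Nat.le_ceil _) h1
  have hqn : (q : ℝ) ≤ (n : ℝ) := by exact_mod_cast Nat.le_mul_of_pos_right q hr0
  have hnδ : (6 : ℝ) ≤ (n : ℝ) ^ δ := by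
    have : ((6 : ℝ) ^ (1 / δ)) ^ δ ≤ (n : ℝ) ^ δ :=
      Real.rpow_le_rpow (by positivity) (hceil.trans hqn) hδ.le
    rwa [← Real.rpow_mul (by norm_num), one_div_mul_cancel hδ.ne', Real.rpow_one] at this
  have hs : ((2 : ℕ) : ℝ) ≤ (n : ℝ) ^ δ := le_trans (by norm_num) hnδ
  have key := H n hn₀ hnodd hnsq 2 (![(4 : ℂ)⁻¹, -(4 : ℂ)⁻¹]) (![A + B, A - B]) (crtW q r) hs hdeg hrep
  -- support-sum ≤ 2(q + r) < 6 q ≤ 6 √n ≤ n^{1/2+δ}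
  have hsuppA : (A.support.card : ℝ) ≤ q := by exact_mod_cast card_support_crtA_le q r
  have hsuppB : (B.support.card : ℝ) ≤ r := by exact_mod_cast card_support_crtB_le q r
  have hsum : (∑ i, (((![A + B, A - B]) i).support.card : ℝ)) ≤ 2 * ((q : ℝ) + r) := by
    simp only [Fin.sum_univ_two, Matrix.cons_val_zero, Matrix.cons_val_one]
    have h1 : (((A + B).support.card : ℕ) : ℝ) ≤ A.support.card + B.support.card := by
      exact_mod_cast crt_card_support_add_le A B
    have h2 : (((A - B).support.card : ℕ) : ℝ) ≤ A.support.card + B.support.card := by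
      exact_mod_cast crt_card_support_sub_le A B
    linarith
  have hr' : (r : ℝ) < 2 * q := by exact_mod_cast hrlt
  have hsqrt : (q : ℝ) ≤ Real.sqrt n := by
    rw [← Real.sqrt_sq (Nat.cast_nonneg q)]
    apply Real.sqrt_le_sqrt
    have : ((q * q : ℕ) : ℝ) ≤ (n : ℝ) := by rw [hn]; exact_mod_cast Nat.mul_le_mul_left q hqr.le
    push_cast at this; nlinarith
  have hsplit : (n : ℝ) ^ (1 / 2 + δ) = Real.sqrt n * (n : ℝ) ^ δ := by
    rw [Real.rpow_add hnpos, ← Real.sqrt_eq_rpow]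
  rw [hsplit] at key
  have hsq0 : (0 : ℝ) ≤ Real.sqrt n := Real.sqrt_nonneg _
  nlinarith

end

end Summit.ValiantsHypothesis.ValiantsHypothesis.Theorems.SOSMagnification.Negative
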